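import Literature.AlgebraicGeometry.Resolution.HuGammaSchemeResolution
import HarnessLib

/-!
# Hu's Γ-schemes: proved sanity lemmas on the shape of the claim `Hu2025IntegralGammaSchemeResolution`

Topic: `Literature/AlgebraicGeometry/Resolution`. Companion (theorem-only) file of
`HuGammaSchemeResolution.lean`, which states Y. Hu's claimed universal characteristic-free
resolution of the integral Γ-schemes `Z_Γ ⊆ 𝕌 ∩ Gr^{3,E}` (arXiv:2507.21400, Thm. 1.3, "in
particular" clause over `𝔽_p`) as the D-0012 claim `Hu2025IntegralGammaSchemeResolution`
(`@[claim "Hu2025" "under-review"]`).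

**Status of the claim (2026-08-17).** NOT discharged and not dischargeable from the literature:
the only proof in print is Hu's own `ϑ`/`℘`/`ℓ` blow-up tower (Part I, §§3–8, unrefereed;
Part II unposted; the author's survey arXiv:2608.10272 of 10 Aug 2026 still calls it an
"announced" proof), and by Lafforgue's form of Mnëv universality (Hu 2025, Thm. 1.1) the claim
is a resolution of every singularity type over `𝔽_p` up to smooth morphisms — i.e. it would
settle (the local form of) resolution of singularities in positive characteristic. The
provefact verdict is `open-problem`; this file does not change that.

## Content (all proved, axioms `propext`/`Classical.choice`/`Quot.sound`)

* `HuGamma.minor_eq_zero_of_not_injective` — a column triple repeating a column has minor `0`.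
* `HuGamma.ideal_eq_bot_of_forall_not_injective`, `HuGamma.ideal_empty` — for such `Γ`
  (e.g. `Γ = ∅`) the Γ-ideal is `⊥`: `Z_Γ = 𝕌 ∩ Gr^{3,E} ≅ 𝔸^{3m}`.
* `HuGamma.smooth_toBase_of_ideal_eq_bot`, `HuGamma.isDomain_ring_of_ideal_eq_bot` — then `Z_Γ`
  is smooth over `R` (polynomial algebras are smooth, Stacks 00TA; `HasRingHomProperty.Spec_iff`)
  and integral when `R` is a domain.
* `Hu2025IntegralGammaSchemeResolution.conclusion_of_smooth` — **Hu's proviso "provided that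
  `Z_Γ` is singular" is immaterial**: if `Z_Γ` is smooth over `𝔽_p` the identity is a proper
  birational morphism from a smooth scheme, so the conclusion of the claim holds; this is the
  formal content of the design note in `HuGammaSchemeResolution.lean` (the tree statement drops
  the proviso without changing the statement).
* `Hu2025IntegralGammaSchemeResolution.case_of_forall_not_injective` — **non-vacuity**: for every
  prime `p`, every `m` and every `Γ` of repeated-column triples, the hypothesis of the claim
  (integrality) is met AND its conclusion holds. (In Hu's tower the case `Γ = ∅` is the smoothness
  of the blown-up universe `Ṽ_ℓ`, Thm. 8.5; before any blow-up it is the smoothness of affine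
  space.)

* `HuGamma.minor_inl`, `HuGamma.minor_frame01/02/12`, `HuGamma.minor_comp_perm`,
  `HuGamma.span_minor_comp_perm` — **§2.2 in the `[I₃ | A]` model**: the de-homogenisation
  `x₁₂₃ = 1`, the basic Plücker variables `x_{12u} = a_{3u}`, `x_{13u} = -a_{2u}`,
  `x_{23u} = a_{1u}`, and alternation under permuting a column triple (so a permuted triple
  generates the same ideal).
* `HuGamma.primaryPlucker_one/two/three/abc` — **Hu's `(123)`-primary de-homogenised Plücker
  relations `F̄_{(123),1uv}`, `F̄_{(123),2uv}`, `F̄_{(123),3uv}`, `F̄_{(123),abc}` (§2.2, p. 10,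
  the set `𝓕` of the `𝓕`-transform `Z_{𝓕,Γ}`)** hold identically for the minors of `[I₃ | A]`:
  `x_{1uv} = x_{12u}x_{13v} - x_{13u}x_{12v}`, `x_{2uv} = x_{12u}x_{23v} - x_{23u}x_{12v}`,
  `x_{3uv} = x_{13u}x_{23v} - x_{23u}x_{13v}`, `x_{abc} = x_{12a}x_{3bc} - x_{13a}x_{2bc} + x_{23a}x_{1bc}`
  — i.e. the tree's model is the closed subscheme `{F̄ = 0}` of Hu's affine space `𝕌` with
  coordinates all `x_u`, as §2.2–2.3 assert.

* `HuGamma.ideal_eq_of_subset_of_forall_minor_mem`, `HuGamma.subset_setOf_minor_mem`,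
  `HuGamma.ideal_setOf_minor_mem`, `HuGamma.setOf_minor_mem_setOf_minor_mem` — **saturating `Γ`
  does not change `Z_Γ`**: `Γ^sat := {u | x_u ∈ I_Γ-minors}` has the same ideal, and is saturated.
* `Hu2025IntegralGammaSchemeResolution.of_ideal_eq`, `.of_forall_saturated`,
  `.iff_forall_saturated` — **WLOG `Γ` is saturated**: the claim is equivalent to its restriction
  to the `Γ` containing every column triple whose minor already lies in the Γ-ideal. This is the
  reduction a formalization of Hu's §7 needs: Lemma 7.3 (3) ("then `x_u ∈ Γ` because `Z†` is
  birational to `Z_Γ`") and the `Γ`-relevant step of §7.2 ("`Z†` is not contained in the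
  exceptional locus") use, for an integral `Z_Γ`, that a Plücker variable vanishing on `Z_Γ`
  belongs to `Γ` — true exactly for saturated `Γ` (e.g. `Γ = {x_{12u}, x_{13u}, x_{23u}}`:
  `x_{1uv} ≡ 0` on `Z_Γ ≅ 𝔸^{3(m-1)}` but `x_{1uv} ∉ Γ`).

## What is NOT here

Anything about singular `Z_Γ` — the first singular members (`m = 2`, `Γ` = one `2 × 2`-type
minor: a cone over the Segre quadric times `𝔸²`; `m = 3`, `Γ` = the `3 × 3` minor of `A`: the
determinantal cubic) already need genuine blow-ups, and no finite list of cases bears on the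
universally quantified claim.
-/

noncomputable section

open CategoryTheory AlgebraicGeometry

namespace Literature.AlgebraicGeometry.Resolution

universe u

namespace HuGamma

/-- A column triple `u` that repeats a column has minor `0` (a determinant with two equal
columns). [folklore] -/
theorem minor_eq_zero_of_not_injective (R : Type u) [CommRing R] (m : ℕ)
    {u : Fin 3 → Fin 3 ⊕ Fin m} (hu : ¬ Function.Injective u) : minor R m u = 0 := by
  obtain ⟨i, j, hij, hne⟩ := Function.not_injective_iff.1 hu
  exact Matrix.det_zero_of_column_eq hne fun k => by simp [Matrix.submatrix_apply, hij]

/-- If every triple in `Γ` repeats a column, the Γ-ideal is `⊥`: no condition is imposed and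
`Z_Γ = 𝕌 ∩ Gr^{3,E} ≅ 𝔸^{3m}`. [folklore] -/
theorem ideal_eq_bot_of_forall_not_injective (R : Type u) [CommRing R] (m : ℕ)
    {Γ : Set (Fin 3 → Fin 3 ⊕ Fin m)} (hΓ : ∀ u ∈ Γ, ¬ Function.Injective u) :
    ideal R m Γ = ⊥ := by
  refine Ideal.span_eq_bot.2 ?_
  rintro _ ⟨u, hu, rfl⟩
  exact minor_eq_zero_of_not_injective R m (hΓ u hu)

/-- In particular `Z_∅ = 𝕌 ∩ Gr^{3,E}` is the whole chart: its ideal is `⊥` (Hu 2025, §1.6,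
p. 9: "when `Γ = ∅`, we have `Z̃_{ℓ,Γ} = Ṽ_ℓ`"). [folklore] -/
theorem ideal_empty (R : Type u) [CommRing R] (m : ℕ) :
    ideal R m (∅ : Set (Fin 3 → Fin 3 ⊕ Fin m)) = ⊥ :=
  ideal_eq_bot_of_forall_not_injective R m (by simp)

/-- When the Γ-ideal is `⊥`, `Z_Γ = 𝔸^{3m}_R` is smooth over `R`: its coordinate ring is
`R`-isomorphic to the polynomial ring `R[a_ij]`, a smooth `R`-algebra (formally smooth and
finitely presented; Stacks, Tag 00TA), and `Smooth (Spec.map φ) ↔ φ.Smooth`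
(`HasRingHomProperty.Spec_iff`). [folklore] -/
theorem smooth_toBase_of_ideal_eq_bot (R : Type u) [CommRing R] (m : ℕ)
    {Γ : Set (Fin 3 → Fin 3 ⊕ Fin m)} (h : ideal R m Γ = ⊥) : Smooth (toBase R m Γ) := by
  have hpoly : Algebra.Smooth R (MvPolynomial (Fin 3 × Fin m) R) := {}
  have hring : Algebra.Smooth R (ring R m Γ) :=
    Algebra.Smooth.of_equiv
      ((AlgEquiv.quotientBot R (MvPolynomial (Fin 3 × Fin m) R)).symm.trans
        (Ideal.quotientEquivAlgOfEq R h.symm))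
  rw [toBase, HasRingHomProperty.Spec_iff (P := @Smooth), CommRingCat.hom_ofHom,
    RingHom.smooth_algebraMap]
  exact hring

/-- When the Γ-ideal is `⊥` and `R` is a domain, `Z_Γ ≅ 𝔸^{3m}_R` is integral. [folklore] -/
theorem isDomain_ring_of_ideal_eq_bot (R : Type u) [CommRing R] [IsDomain R] (m : ℕ)
    {Γ : Set (Fin 3 → Fin 3 ⊕ Fin m)} (h : ideal R m Γ = ⊥) : IsDomain (ring R m Γ) :=
  ((AlgEquiv.quotientBot R (MvPolynomial (Fin 3 × Fin m) R)).symm.trans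
      (Ideal.quotientEquivAlgOfEq R h.symm)).symm.toMulEquiv.isDomain
    (MvPolynomial (Fin 3 × Fin m) R)


/-! ### §2.2 of Hu 2025 in the `[I₃ | A]` model: Plücker variables and the primary relations -/

section Plucker

variable (R : Type u) [CommRing R] (m : ℕ)

/-- **De-homogenisation `x₁₂₃ = 1`**: the frame triple has minor `1` (the chart is
`p₁₂₃ ≠ 0`, normalised to `1`). [cite: Hu2025, §2.2 (p. 10)] -/
theorem minor_inl : minor R m Sum.inl = 1 := by
  simp [minor, frameMatrix, Matrix.det_fin_three, Matrix.submatrix_apply]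

/-- **Basic variable `x_{12u} = a_{3u}`** (rows indexed from `0`: `X (2, u)`).
[cite: Hu2025, §2.2 (p. 10)] -/
theorem minor_frame01 (u : Fin m) :
    minor R m ![Sum.inl 0, Sum.inl 1, Sum.inr u] = MvPolynomial.X (2, u) := by
  simp [minor, frameMatrix, Matrix.det_fin_three, Matrix.submatrix_apply]

/-- **Basic variable `x_{13u} = -a_{2u}`** (`-X (1, u)`). [cite: Hu2025, §2.2 (p. 10)] -/
theorem minor_frame02 (u : Fin m) :
    minor R m ![Sum.inl 0, Sum.inl 2, Sum.inr u] = - MvPolynomial.X (1, u) := by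
  simp [minor, frameMatrix, Matrix.det_fin_three, Matrix.submatrix_apply]

/-- **Basic variable `x_{23u} = a_{1u}`** (`X (0, u)`). [cite: Hu2025, §2.2 (p. 10)] -/
theorem minor_frame12 (u : Fin m) :
    minor R m ![Sum.inl 1, Sum.inl 2, Sum.inr u] = MvPolynomial.X (0, u) := by
  simp [minor, frameMatrix, Matrix.det_fin_three, Matrix.submatrix_apply]

/-- **Alternation**: permuting an ordered column triple multiplies its minor by the sign of the
permutation (so `Γ` may be taken to consist of increasing triples, as in Hu's `I_{3,n}`).
[folklore] -/
theorem minor_comp_perm (u : Fin 3 → Fin 3 ⊕ Fin m) (σ : Equiv.Perm (Fin 3)) :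
    minor R m (u ∘ σ) = Equiv.Perm.sign σ * minor R m u := by
  rw [minor, minor, ← Matrix.det_permute']
  rfl

/-- Hence a permuted triple generates the same principal ideal. [folklore] -/
theorem span_minor_comp_perm (u : Fin 3 → Fin 3 ⊕ Fin m) (σ : Equiv.Perm (Fin 3)) :
    Ideal.span {minor R m (u ∘ σ)} = Ideal.span {minor R m u} := by
  rw [minor_comp_perm]
  refine Ideal.span_singleton_mul_left_unit ?_ _
  rcases Int.units_eq_one_or (Equiv.Perm.sign σ) with h | h <;> simp [h]

/-- **Primary Plücker relation `F̄_{(123),1uv} = x_{1uv} - x_{12u}x_{13v} + x_{13u}x_{12v}`**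
(Hu 2025, §2.2, p. 10) holds identically in the `[I₃ | A]` model:
`x_{1uv} = x_{12u}x_{13v} - x_{13u}x_{12v}`. [cite: Hu2025, §2.2 (p. 10)] -/
theorem primaryPlucker_one (u v : Fin m) :
    minor R m ![Sum.inl 0, Sum.inr u, Sum.inr v] =
      minor R m ![Sum.inl 0, Sum.inl 1, Sum.inr u] * minor R m ![Sum.inl 0, Sum.inl 2, Sum.inr v] -
        minor R m ![Sum.inl 0, Sum.inl 2, Sum.inr u] *
          minor R m ![Sum.inl 0, Sum.inl 1, Sum.inr v] := by
  simp [minor, frameMatrix, Matrix.det_fin_three, Matrix.submatrix_apply]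
  ring

/-- **Primary Plücker relation `F̄_{(123),2uv} = x_{2uv} - x_{12u}x_{23v} + x_{23u}x_{12v}`**
(Hu 2025, §2.2, p. 10): `x_{2uv} = x_{12u}x_{23v} - x_{23u}x_{12v}`. [cite: Hu2025, §2.2 (p. 10)] -/
theorem primaryPlucker_two (u v : Fin m) :
    minor R m ![Sum.inl 1, Sum.inr u, Sum.inr v] =
      minor R m ![Sum.inl 0, Sum.inl 1, Sum.inr u] * minor R m ![Sum.inl 1, Sum.inl 2, Sum.inr v] -
        minor R m ![Sum.inl 1, Sum.inl 2, Sum.inr u] *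
          minor R m ![Sum.inl 0, Sum.inl 1, Sum.inr v] := by
  simp [minor, frameMatrix, Matrix.det_fin_three, Matrix.submatrix_apply]
  ring

/-- **Primary Plücker relation `F̄_{(123),3uv} = x_{3uv} - x_{13u}x_{23v} + x_{23u}x_{13v}`**
(Hu 2025, §2.2, p. 10): `x_{3uv} = x_{13u}x_{23v} - x_{23u}x_{13v}`. [cite: Hu2025, §2.2 (p. 10)] -/
theorem primaryPlucker_three (u v : Fin m) :
    minor R m ![Sum.inl 2, Sum.inr u, Sum.inr v] =
      minor R m ![Sum.inl 0, Sum.inl 2, Sum.inr u] * minor R m ![Sum.inl 1, Sum.inl 2, Sum.inr v] -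
        minor R m ![Sum.inl 1, Sum.inl 2, Sum.inr u] *
          minor R m ![Sum.inl 0, Sum.inl 2, Sum.inr v] := by
  simp [minor, frameMatrix, Matrix.det_fin_three, Matrix.submatrix_apply]
  ring

/-- **Primary Plücker relation
`F̄_{(123),abc} = x_{abc} - x_{12a}x_{3bc} + x_{13a}x_{2bc} - x_{23a}x_{1bc}`** (Hu 2025, §2.2,
p. 10): `x_{abc} = x_{12a}x_{3bc} - x_{13a}x_{2bc} + x_{23a}x_{1bc}` — the Laplace expansion of
the `3 × 3` minor of `A` along its first column, in Plücker variables.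
[cite: Hu2025, §2.2 (p. 10)] -/
theorem primaryPlucker_abc (a b c : Fin m) :
    minor R m ![Sum.inr a, Sum.inr b, Sum.inr c] =
      minor R m ![Sum.inl 0, Sum.inl 1, Sum.inr a] * minor R m ![Sum.inl 2, Sum.inr b, Sum.inr c] -
        minor R m ![Sum.inl 0, Sum.inl 2, Sum.inr a] *
            minor R m ![Sum.inl 1, Sum.inr b, Sum.inr c] +
          minor R m ![Sum.inl 1, Sum.inl 2, Sum.inr a] *
            minor R m ![Sum.inl 0, Sum.inr b, Sum.inr c] := by
  simp [minor, frameMatrix, Matrix.det_fin_three, Matrix.submatrix_apply]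
  ring

end Plucker

end HuGamma

/-- **Hu's proviso "provided that `Z_Γ` is singular" is immaterial.** If `Z_Γ` is already
smooth over `𝔽_p`, the conclusion of `Hu2025IntegralGammaSchemeResolution` holds for it with
`Z' = Z_Γ` and `π = 𝟙`: the identity is proper and birational (over `U = Z_Γ`), and
`𝟙 ≫ toBase` is the smooth structure morphism. This is the formal content of the design note in
`HuGammaSchemeResolution.lean` (dropping the proviso does not change the statement, since over
the perfect field `𝔽_p` "non-singular" is "smooth"). [folklore] -/
theorem Hu2025IntegralGammaSchemeResolution.conclusion_of_smooth (p : ℕ) (m : ℕ)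
    (Γ : Set (Fin 3 → Fin 3 ⊕ Fin m)) [Smooth (HuGamma.toBase (ZMod p) m Γ)] :
    ∃ (Z' : Scheme.{0}) (π : Z' ⟶ Spec (.of (HuGamma.ring (ZMod p) m Γ))),
      IsProper π ∧ IsBirational π ∧ Smooth (π ≫ HuGamma.toBase (ZMod p) m Γ) := by
  refine ⟨_, 𝟙 _, inferInstance, ⟨⊤, by simp, by simp, inferInstance⟩, ?_⟩
  simpa using ‹Smooth (HuGamma.toBase (ZMod p) m Γ)›

/-- **Non-vacuity / trivial members of the family.** For every prime `p`, every `m` and every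
`Γ` all of whose triples repeat a column (in particular `Γ = ∅`, `Z_∅ = 𝕌 ∩ Gr^{3,E} = 𝔸^{3m}`),
the hypothesis of `Hu2025IntegralGammaSchemeResolution` is met (`Z_Γ` is integral) AND its
conclusion holds (by the identity, `Z_Γ` being smooth): the claim is consistent and its
hypothesis is satisfiable in every characteristic. (In Hu's tower the case `Γ = ∅` is the
smoothness of the blown-up universe `Ṽ_ℓ` itself, Thm. 8.5; before any blow-up it is just the
smoothness of affine space.) This says nothing about singular `Z_Γ`, where the claim is open.
[folklore] -/
theorem Hu2025IntegralGammaSchemeResolution.case_of_forall_not_injective (p : ℕ) [Fact p.Prime]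
    (m : ℕ) (Γ : Set (Fin 3 → Fin 3 ⊕ Fin m)) (hΓ : ∀ u ∈ Γ, ¬ Function.Injective u) :
    IsDomain (HuGamma.ring (ZMod p) m Γ) ∧
      ∃ (Z' : Scheme.{0}) (π : Z' ⟶ Spec (.of (HuGamma.ring (ZMod p) m Γ))),
        IsProper π ∧ IsBirational π ∧ Smooth (π ≫ HuGamma.toBase (ZMod p) m Γ) := by
  have h := HuGamma.ideal_eq_bot_of_forall_not_injective (ZMod p) m hΓ
  haveI := HuGamma.smooth_toBase_of_ideal_eq_bot (ZMod p) m h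
  exact ⟨HuGamma.isDomain_ring_of_ideal_eq_bot (ZMod p) m h,
    Hu2025IntegralGammaSchemeResolution.conclusion_of_smooth p m Γ⟩

/-! ### WLOG `Γ` is saturated (the reduction needed by Hu §7, Lemma 7.3) -/

namespace HuGamma

variable (R : Type u) [CommRing R] (m : ℕ)

/-- Enlarging `Γ` by column triples whose minors already lie in the Γ-ideal does not change the
ideal (hence not the scheme `Z_Γ`). [cite: Hu2025, §7.1 Def. 7.1] -/
theorem ideal_eq_of_subset_of_forall_minor_mem {Γ Γ' : Set (Fin 3 → Fin 3 ⊕ Fin m)}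
    (hsub : Γ ⊆ Γ') (hmem : ∀ u ∈ Γ', minor R m u ∈ ideal R m Γ) :
    ideal R m Γ' = ideal R m Γ := by
  apply le_antisymm
  · rw [ideal, Ideal.span_le]
    rintro _ ⟨u, hu, rfl⟩
    exact hmem u hu
  · exact Ideal.span_mono (Set.image_mono hsub)

/-- `Γ ⊆ Γ^sat := {u | x_u ∈ (Γ-minors)}`. [folklore] -/
theorem subset_setOf_minor_mem (Γ : Set (Fin 3 → Fin 3 ⊕ Fin m)) :
    Γ ⊆ {u | minor R m u ∈ ideal R m Γ} := fun u hu =>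
  Ideal.subset_span ⟨u, hu, rfl⟩

/-- **The saturation `Γ^sat` has the same ideal**: `Z_{Γ^sat} = Z_Γ` as closed subschemes of
`𝕌 ∩ Gr^{3,E}`. [cite: Hu2025, §7.1 Def. 7.1] -/
theorem ideal_setOf_minor_mem (Γ : Set (Fin 3 → Fin 3 ⊕ Fin m)) :
    ideal R m {u | minor R m u ∈ ideal R m Γ} = ideal R m Γ :=
  ideal_eq_of_subset_of_forall_minor_mem R m (subset_setOf_minor_mem R m Γ) fun _ hu => hu

/-- The saturation is saturated: `(Γ^sat)^sat = Γ^sat`. [folklore] -/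
theorem setOf_minor_mem_setOf_minor_mem (Γ : Set (Fin 3 → Fin 3 ⊕ Fin m)) :
    {u | minor R m u ∈ ideal R m {u | minor R m u ∈ ideal R m Γ}} =
      {u | minor R m u ∈ ideal R m Γ} := by
  ext u
  simp only [Set.mem_setOf_eq, ideal_setOf_minor_mem]

end HuGamma

/-- The conclusion of the claim for `Γ₂` follows from that for `Γ₁` when the two Γ-ideals agree
(the rings, structure maps and hypotheses are then literally the same). [folklore] -/
theorem Hu2025IntegralGammaSchemeResolution.of_ideal_eq (p : ℕ) (m : ℕ)
    {Γ₁ Γ₂ : Set (Fin 3 → Fin 3 ⊕ Fin m)}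
    (h : HuGamma.ideal (ZMod p) m Γ₁ = HuGamma.ideal (ZMod p) m Γ₂)
    (h₁ : IsDomain (HuGamma.ring (ZMod p) m Γ₁) →
      ∃ (Z' : Scheme.{0}) (π : Z' ⟶ Spec (.of (HuGamma.ring (ZMod p) m Γ₁))),
        IsProper π ∧ IsBirational π ∧ Smooth (π ≫ HuGamma.toBase (ZMod p) m Γ₁)) :
    IsDomain (HuGamma.ring (ZMod p) m Γ₂) →
      ∃ (Z' : Scheme.{0}) (π : Z' ⟶ Spec (.of (HuGamma.ring (ZMod p) m Γ₂))),
        IsProper π ∧ IsBirational π ∧ Smooth (π ≫ HuGamma.toBase (ZMod p) m Γ₂) := by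
  let Q : Ideal (MvPolynomial (Fin 3 × Fin m) (ZMod p)) → Prop := fun I =>
    IsDomain (MvPolynomial (Fin 3 × Fin m) (ZMod p) ⧸ I) →
      ∃ (Z' : Scheme.{0}) (π : Z' ⟶ Spec (.of (MvPolynomial (Fin 3 × Fin m) (ZMod p) ⧸ I))),
        IsProper π ∧ IsBirational π ∧
          Smooth (π ≫ Spec.map (CommRingCat.ofHom
            (algebraMap (ZMod p) (MvPolynomial (Fin 3 × Fin m) (ZMod p) ⧸ I))))
  have hQ : Q (HuGamma.ideal (ZMod p) m Γ₁) := h₁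
  rw [h] at hQ
  exact hQ

/-- **WLOG `Γ` is saturated.** The claim follows from its restriction to SATURATED `Γ` — those
containing every column triple `u` whose minor `x_u` already lies in the Γ-ideal — since
`Z_Γ = Z_{Γ^sat}` (`HuGamma.ideal_setOf_minor_mem`). For integral `Z_Γ` and saturated `Γ`, a
Plücker variable vanishing identically on `Z_Γ` belongs to `Γ` (the ideal `(Γ, 𝓕)` is prime),
which is what Hu's Lemma 7.3 (3) and the `Γ`-relevant step of §7.2 use.
[cite: Hu2025, §7.2 Lemma 7.3] -/
theorem Hu2025IntegralGammaSchemeResolution.of_forall_saturated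
    (h : ∀ (p : ℕ) [Fact p.Prime] (m : ℕ) (Γ : Set (Fin 3 → Fin 3 ⊕ Fin m)),
      (∀ u, HuGamma.minor (ZMod p) m u ∈ HuGamma.ideal (ZMod p) m Γ → u ∈ Γ) →
        IsDomain (HuGamma.ring (ZMod p) m Γ) →
          ∃ (Z' : Scheme.{0}) (π : Z' ⟶ Spec (.of (HuGamma.ring (ZMod p) m Γ))),
            IsProper π ∧ IsBirational π ∧ Smooth (π ≫ HuGamma.toBase (ZMod p) m Γ)) :
    Hu2025IntegralGammaSchemeResolution := by
  intro p _ m Γ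
  refine Hu2025IntegralGammaSchemeResolution.of_ideal_eq p m
    (HuGamma.ideal_setOf_minor_mem (ZMod p) m Γ) (h p m _ fun u hu => ?_)
  rwa [Set.mem_setOf_eq, ← HuGamma.ideal_setOf_minor_mem (ZMod p) m Γ]

/-- **The claim is equivalent to its saturated form.** [cite: Hu2025, §7.2 Lemma 7.3] -/
theorem Hu2025IntegralGammaSchemeResolution.iff_forall_saturated :
    Hu2025IntegralGammaSchemeResolution ↔
      ∀ (p : ℕ) [Fact p.Prime] (m : ℕ) (Γ : Set (Fin 3 → Fin 3 ⊕ Fin m)),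
        (∀ u, HuGamma.minor (ZMod p) m u ∈ HuGamma.ideal (ZMod p) m Γ → u ∈ Γ) →
          IsDomain (HuGamma.ring (ZMod p) m Γ) →
            ∃ (Z' : Scheme.{0}) (π : Z' ⟶ Spec (.of (HuGamma.ring (ZMod p) m Γ))),
              IsProper π ∧ IsBirational π ∧ Smooth (π ≫ HuGamma.toBase (ZMod p) m Γ) :=
  ⟨fun h p _ m Γ _ hdom => h p m Γ hdom, Hu2025IntegralGammaSchemeResolution.of_forall_saturated⟩

end Literature.AlgebraicGeometry.Resolution

end
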